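import Summits.BirchSwinnertonDyer.Rank1Residual.Additive.X4ThreeVisiblePlacesSevenKinds
import Summits.BirchSwinnertonDyer.Rank1Residual.GaloisImage.LocalThreeTorsionDeciderAtCert
import HarnessLib

/-!
# Kinds (i), (ii), (vii) of the REFINED visibility certificate decided by the CERTIFICATE-FORM local
# `3`-torsion decider (split-cover root census, O(1) in the prime) — records plumbing
# (cell `b2b-bsdres`, team n1011, row T-D31891 FILE 3; seat p04 GEN 15; the twins of n1011-p09's
# `PlacesSeven.kind_i_of_checkAt` / `kind_ii_of_roots_of_checkAt` / `kind_vii_of_checkAt`)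

HONEST FRAMING (cell `b2b-bsdres`, run/shared/lean/b2b/bsd-rank1-residual/, verbatim in every
file): the goal of the cell is to DELETE the COMBINATION-SHAPED residual classes of the
Birch–Swinnerton-Dyer formula for ALL analytic-rank `≤ 1` elliptic curves over `ℚ` — "full BSD
formula for every rank `≤ 1` curve in class `C`" assembled STRICTLY from published theorems — so
that the rank-`≤ 1` remainder becomes exactly the CONSTRUCTION-SHAPED classes, which are TYPED
(missing-input `Prop`s), NOT attempted. This is not "finishing BSD". Team n1011 (N10 / N11, the
additive block X4 ∧ `p = 3`): research route on the CONSTRUCTION-SHAPED class X4; no claim beyond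
the stated classes; nothing is booked; no mark / label / count / road letter is changed by this file.
THIS FILE IS A TOOL: theorems only (no definition, no named fact, no `sorry`); it closes nothing by
itself — it is records PLUMBING for the `hplaces` binder of n1011-p04's seven-kind sockets
(`Additive/X4RankZeroVisibleRefinedCertificateSockets.lean`), exactly as n1011-p09's
`Additive/X4ThreeVisiblePlacesSevenKinds.lean`, with n1011-p17's enumerative decider
`LocalTorsion3At.threeTorsionCheckAt q … k cert` replaced by the certificate-form
`LocalTorsion3At.threeTorsionCertAt q … k cert lin` of T-D31891 FILE 2 (root census by a split cover
`Ψ₃ ≡ 3 · ∏ (X − rᵢ)^{eᵢ} (mod q)`, FILE 1): the kernel cost no longer grows with `q`.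

## What

* `PlacesSeven.kind_ii_of_roots_of_certAt` — kind (ii): both curves SPLIT multiplicative at `v` (root
  certificates of the node-tangent quadratics, `q ∣ Δ`, `q ∤ c₄`, p17's D9
  `DivisionDecider.hasSplitMultiplicativeReductionAt_of_intModel_of_root`) and `#E(ℚ_v)[3] ≤ 3` from
  `threeTorsionCertAt q (E₀) k cert lin = some S`, `S ≤ 1`.  At every multiplicative `q ≥ 5`,
  `Ψ₃ mod q = 3 (X − x_t)(X − x₀)³` splits, so a certificate ALWAYS exists here; first consumer: the
  190th D44 row 287019b1 at `q = 31891` (`Additive/X4ThreeVisibleRowShapesD44_97.lean`).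
* `PlacesSeven.kind_i_of_certAt`, `PlacesSeven.kind_vii_of_certAt` — kinds (i) and (vii) in the same
  currency, usable whenever `Ψ₃ mod q` happens to split into linear factors (else p09's `…_of_checkAt`).

References: [SilvermanAEC2009] VII.5 Prop. 5.1, VII.3.1 and Ex. 3.7; cells/n1011/ROUTE-1.md §44
(L44), §65.1 (design note D-31891).
-/

set_option autoImplicit false

noncomputable section

open scoped Classical NumberField
open IsDedekindDomain NumberField WeierstrassCurve Rat.HeightOneSpectrum
  Literature.NumberTheory.EllipticCurves Literature.NumberTheory.EllipticCurves.Rank1Residual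
  Summit.BirchSwinnertonDyer.BirchSwinnertonDyer.Rank1Residual.IntModel
  Summit.BirchSwinnertonDyer.Rank1Residual.GaloisImage
  Summit.BirchSwinnertonDyer.Rank1Residual.GaloisImage.LocalTorsion3At

namespace Summit.BirchSwinnertonDyer.Rank1Residual.Additive.PlacesSeven

variable (q : ℕ) [hq : Fact q.Prime]

/-! ### Kind (i): `3 ∉ v`, `#E′(ℚ_v)[3] = 1` -/

/-- **Kind (i), decided by certificate** (`q ≠ 3`): `((3 : ℕ) : 𝓞 ℚ) ∉ v ∧ #ker([3] : E′(ℚ_v)) = 1`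
for the partner `W′` with integer model `⟨a₁, …, a₆⟩` from
`threeTorsionCertAt q a₁ … a₆ k cert lin = some 0`. [cite: SilvermanAEC2009, VII.3.1 and Ex. 3.7] -/
theorem kind_i_of_certAt (hq3 : q ≠ 3) (W' : WeierstrassCurve ℚ) [W'.IsElliptic] [W'.IsGloballyMinimal]
    {a₁ a₂ a₃ a₄ a₆ : ℤ} (hI' : W'.integralModelInt = ⟨a₁, a₂, a₃, a₄, a₆⟩)
    {v : HeightOneSpectrum (𝓞 ℚ)} (hv : (primesEquiv v : ℕ) = q)
    {k : ℕ} {cert : List (ℤ × ℕ × ℕ × ℕ)} {lin : List (ℤ × ℕ)}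
    (h : threeTorsionCertAt q a₁ a₂ a₃ a₄ a₆ k cert lin = some 0) :
    ((3 : ℕ) : 𝓞 ℚ) ∉ v.asIdeal ∧
      Nat.card (nsmulAddMonoidHom 3 : (W'.baseChange (v.adicCompletion ℚ)).toAffine.Point →+
        (W'.baseChange (v.adicCompletion ℚ)).toAffine.Point).ker = 1 := by
  refine ⟨three_notMem_asIdeal_of_primesEquiv_eq q hq3 hv, ?_⟩
  rw [natCard_ker_nsmul_three_adicCompletion_eq_of_intModel_of_certAt q a₁ a₂ a₃ a₄ a₆ hq3 W' hI' h hv]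

/-! ### Kind (ii): split / split, `#E(ℚ_v)[3] ≤ 3` -/

/-- **Kind (ii), decided by certificate**: both curves SPLIT multiplicative at `v` (root certificates
`t`, `t′` of the node-tangent quadratics of `E₀`, `F₀` mod `q`; `q ∣ Δ`, `q ∤ c₄`) and
`#ker([3] : E(ℚ_v)) ≤ 3` from `threeTorsionCertAt q (E₀) k cert lin = some S`, `S ≤ 1` (`q ≠ 3`) —
n1011-p09's `kind_ii_of_roots_of_checkAt` over the certificate-form decider.
[cite: SilvermanAEC2009, VII.5 Prop. 5.1 (b)] [cite: SilvermanAEC2009, VII.3.1 and Ex. 3.7] -/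
theorem kind_ii_of_roots_of_certAt (hq3 : q ≠ 3) (W W' : WeierstrassCurve ℚ) [W.IsElliptic]
    [W'.IsElliptic] [W.IsGloballyMinimal] [W'.IsGloballyMinimal] {a₁ a₂ a₃ a₄ a₆ : ℤ}
    {F₀ : WeierstrassCurve ℤ} (hI : W.integralModelInt = ⟨a₁, a₂, a₃, a₄, a₆⟩)
    (hI' : W'.integralModelInt = F₀) {v : HeightOneSpectrum (𝓞 ℚ)} (hv : (primesEquiv v : ℕ) = q)
    (hΔ : (q : ℤ) ∣ (⟨a₁, a₂, a₃, a₄, a₆⟩ : WeierstrassCurve ℤ).Δ)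
    (hc₄ : ¬ (q : ℤ) ∣ (⟨a₁, a₂, a₃, a₄, a₆⟩ : WeierstrassCurve ℤ).c₄) (t : ZMod q)
    (ht : ((⟨a₁, a₂, a₃, a₄, a₆⟩ : WeierstrassCurve ℤ).c₄ : ZMod q) * t ^ 2 +
      ((a₁ * (⟨a₁, a₂, a₃, a₄, a₆⟩ : WeierstrassCurve ℤ).c₄ : ℤ) : ZMod q) * t -
      ((54 * (⟨a₁, a₂, a₃, a₄, a₆⟩ : WeierstrassCurve ℤ).b₆ -
        3 * (⟨a₁, a₂, a₃, a₄, a₆⟩ : WeierstrassCurve ℤ).b₂ * (⟨a₁, a₂, a₃, a₄, a₆⟩ : WeierstrassCurve ℤ).b₄ +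
        a₂ * (⟨a₁, a₂, a₃, a₄, a₆⟩ : WeierstrassCurve ℤ).c₄ : ℤ) : ZMod q) = 0)
    (hΔ' : (q : ℤ) ∣ F₀.Δ) (hc₄' : ¬ (q : ℤ) ∣ F₀.c₄) (t' : ZMod q)
    (ht' : (F₀.c₄ : ZMod q) * t' ^ 2 + ((F₀.a₁ * F₀.c₄ : ℤ) : ZMod q) * t' -
      ((54 * F₀.b₆ - 3 * F₀.b₂ * F₀.b₄ + F₀.a₂ * F₀.c₄ : ℤ) : ZMod q) = 0)
    {k S : ℕ} {cert : List (ℤ × ℕ × ℕ × ℕ)} {lin : List (ℤ × ℕ)}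
    (h : threeTorsionCertAt q a₁ a₂ a₃ a₄ a₆ k cert lin = some S) (hS : S ≤ 1) :
    W.HasSplitMultiplicativeReductionAt v ∧ W'.HasSplitMultiplicativeReductionAt v ∧
      Nat.card (nsmulAddMonoidHom 3 : (W.baseChange (v.adicCompletion ℚ)).toAffine.Point →+
        (W.baseChange (v.adicCompletion ℚ)).toAffine.Point).ker ≤ 3 := by
  refine ⟨DivisionDecider.hasSplitMultiplicativeReductionAt_of_intModel_of_root q W hI hv hΔ hc₄ t ht,
    DivisionDecider.hasSplitMultiplicativeReductionAt_of_intModel_of_root q W' hI' hv hΔ' hc₄' t' ht', ?_⟩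
  rw [natCard_ker_nsmul_three_adicCompletion_eq_of_intModel_of_certAt q a₁ a₂ a₃ a₄ a₆ hq3 W hI h hv]
  omega

/-! ### Kind (vii): additive / additive, `3 ∉ v`, `#E′(ℚ_v)[3] = 3` -/

/-- **Kind (vii), decided by certificate** (`q ≠ 3`): both curves ADDITIVE at `v` (`q ∣ Δ`, `q ∣ c₄` on
`E₀` and on the partner's model `⟨a₁, …, a₆⟩`), `3 ∉ v`, and `#ker([3] : E′(ℚ_v)) = 3` from
`threeTorsionCertAt q a₁ … a₆ k cert lin = some 1`. [cite: SilvermanAEC2009, VII.5 Prop. 5.1 (c)]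
[cite: SilvermanAEC2009, VII.3.1 and Ex. 3.7] -/
theorem kind_vii_of_certAt (hq3 : q ≠ 3) (W W' : WeierstrassCurve ℚ) [W.IsElliptic] [W'.IsElliptic]
    [W.IsGloballyMinimal] [W'.IsGloballyMinimal] {E₀ : WeierstrassCurve ℤ} {a₁ a₂ a₃ a₄ a₆ : ℤ}
    (hI : W.integralModelInt = E₀) (hI' : W'.integralModelInt = ⟨a₁, a₂, a₃, a₄, a₆⟩)
    {v : HeightOneSpectrum (𝓞 ℚ)} (hv : (primesEquiv v : ℕ) = q)
    (hΔ : (q : ℤ) ∣ E₀.Δ) (hc₄ : (q : ℤ) ∣ E₀.c₄)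
    (hΔ' : (q : ℤ) ∣ (⟨a₁, a₂, a₃, a₄, a₆⟩ : WeierstrassCurve ℤ).Δ)
    (hc₄' : (q : ℤ) ∣ (⟨a₁, a₂, a₃, a₄, a₆⟩ : WeierstrassCurve ℤ).c₄)
    {k : ℕ} {cert : List (ℤ × ℕ × ℕ × ℕ)} {lin : List (ℤ × ℕ)}
    (h : threeTorsionCertAt q a₁ a₂ a₃ a₄ a₆ k cert lin = some 1) :
    W.HasAdditiveReductionAt v ∧ W'.HasAdditiveReductionAt v ∧ ((3 : ℕ) : 𝓞 ℚ) ∉ v.asIdeal ∧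
      Nat.card (nsmulAddMonoidHom 3 : (W'.baseChange (v.adicCompletion ℚ)).toAffine.Point →+
        (W'.baseChange (v.adicCompletion ℚ)).toAffine.Point).ker = 3 := by
  refine ⟨hasAdditiveReductionAt_of_intModel q W hI hv hΔ hc₄,
    hasAdditiveReductionAt_of_intModel q W' hI' hv hΔ' hc₄', three_notMem_asIdeal_of_primesEquiv_eq q hq3 hv, ?_⟩
  rw [natCard_ker_nsmul_three_adicCompletion_eq_of_intModel_of_certAt q a₁ a₂ a₃ a₄ a₆ hq3 W' hI' h hv]

end Summit.BirchSwinnertonDyer.Rank1Residual.Additive.PlacesSeven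

end
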